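import Mathlib.MeasureTheory.Constructions.Pi
import Mathlib.RingTheory.TensorProduct.Free
import Mathlib.RingTheory.FiniteType
import Literature.NumberTheory.Automorphic.MatrixAdeleHaarChar
import Literature.RingTheory.CentralSimple.MulLeftRight
import HarnessLib

/-!
# Equality of the left and right modules on `(𝔸_K ⊗_K D)ˣ` for a central simple algebra `D`

Discharge of the named fact `addHaar_units_smul_eq_op_smul K D` of
`QuaternionAlgebraAdelicProofs` (Vignéras, *Arithmétique des algèbres de quaternions*, LNM 800,
Ch. II §4, Définition: the module of `x ∈ Xˣ` is "le module commun des deux isomorphismes de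
multiplication à gauche, ou à droite"; Weil, *Basic Number Theory*, Ch. IV §3 Cor. of Prop. 3 with
Ch. IX §2 Prop. 6 Cor. 1: the regular and coregular norms of a simple algebra coincide): for a
finite-dimensional central simple algebra `D` over a number field `K` and a unit `u` of
`D_𝔸 = 𝔸_K ⊗_K D`, `vol(u Z) = vol(Z u)` for every additive Haar measure.

## Proof

Let `N = dim_K D` and `A = D_𝔸`. Instead of determinants and splitting fields we use:

* `Literature.RingTheory.CentralSimple.bijective_sum_mulLeft_comp_mulRight` — the Azumaya
  property of `D`: every `K`-linear endomorphism of `D` is uniquely `x ↦ ∑ᵢ aᵢ x βᵢ` for a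
  `K`-basis `(βᵢ)`; base-changed to `𝔸_K` (surjectivity by base change, injectivity by the
  Orzech property of commutative rings) it gives an `𝔸_K`-linear, hence bi-continuous,
  isomorphism `e : Aᴺ ≅ M_N(𝔸_K)`, `(aᵢ)ᵢ ↦ ∑ᵢ ℓ(aᵢ) r(βᵢ)` (`ℓ`, `r` the matrices of left and
  right multiplication), which intertwines coordinatewise left multiplication by `u ∈ Aˣ` with
  left multiplication by the matrix `ℓ(u) ∈ GL_N(𝔸_K)`, and coordinatewise right multiplication
  by `u` with right multiplication by the same `ℓ(u)` (left and right multiplications commute):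
  `ScalarExtension.exists_continuousAddEquiv_pi_matrix`;
* `distribHaarChar_matrix_adele_eq_op` (`MatrixAdeleHaarChar`): `X ↦ g X` and `X ↦ X g` have the
  same module on `M_N(𝔸_K)` for every `g ∈ GL_N(𝔸_K)` (Iwasawa decomposition argument);
* `distribHaarChar_pi`: the coordinatewise action on `Aᴺ` has module `Δ(u)ᴺ`.

Hence `Δ_left(u)ᴺ = Δ_right(u)ᴺ`, so `Δ_left(u) = Δ_right(u)`.

## References

* M.-F. Vignéras, *Arithmétique des algèbres de quaternions*, LNM 800 (1980), Ch. II §4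
  (Définition du module), Ch. III §1 [VignerasLNM800].
* A. Weil, *Basic Number Theory* (1967), Ch. IV §3 Prop. 3 and Cor.; Ch. IX §2 Prop. 6 Cor. 1
  [WeilBNT1967].
-/

noncomputable section

open scoped TensorProduct NNReal ENNReal Pointwise MatrixGroups
open NumberField IsDedekindDomain MeasureTheory Measure

namespace Literature.NumberTheory.Automorphic

universe u

/-! ### The module of a diagonal action on a finite power -/

section PiPower

/-- **Module of a diagonal action on a finite power.** If `g` acts on `X` with module `Δ(g)`, it
acts coordinatewise on `X^ι` with module `Δ(g)^{#ι}` (product Haar measure). [folklore] -/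
theorem distribHaarChar_pi {G X : Type*} [Group G] [AddCommGroup X] [DistribMulAction G X]
    [TopologicalSpace X] [IsTopologicalAddGroup X] [LocallyCompactSpace X]
    [ContinuousConstSMul G X] [SecondCountableTopology X] (ι : Type*) [Fintype ι] (g : G) :
    distribHaarChar (ι → X) g = distribHaarChar X g ^ Fintype.card ι := by
  borelize X
  set μ₀ : Measure X := Measure.addHaar with hμ₀
  obtain ⟨k⟩ := (inferInstance : Nonempty (TopologicalSpace.PositiveCompacts X))
  have hk0 : μ₀ k ≠ 0 := (measure_pos_of_nonempty_interior μ₀ k.interior_nonempty).ne'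
  have hktop : μ₀ k ≠ ∞ := k.isCompact.measure_lt_top.ne
  have hμs : Measure.pi (fun _ : ι => μ₀) (Set.univ.pi fun _ => (k : Set X)) =
      μ₀ k ^ Fintype.card ι := by
    rw [Measure.pi_pi, Finset.prod_const, Finset.card_univ]
  refine distribHaarChar_eq_of_measure_smul_eq_mul (μ := Measure.pi fun _ : ι => μ₀)
    (s := Set.univ.pi fun _ => (k : Set X)) (by rw [hμs]; exact pow_ne_zero _ hk0)
    (by rw [hμs]; exact ENNReal.pow_ne_top hktop) ?_
  rw [hμs, Set.smul_set_univ_pi, Measure.pi_pi]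
  simp only [Pi.smul_apply, ← distribHaarChar_mul μ₀, Finset.prod_const, Finset.card_univ,
    mul_pow, ENNReal.coe_pow]

end PiPower

/-! ### The sandwich isomorphism `Aᴺ ≅ M_N(R)` for `A = R ⊗_K D`, `D` central simple -/

section Sandwich

variable (K : Type*) [Field K] (R : Type*) [CommRing R] [Algebra K R] [TopologicalSpace R]
  [IsTopologicalRing R] (D : Type*) [Ring D] [Algebra K D]

/-- **The sandwich isomorphism.** Let `D` be a finite-dimensional central simple algebra over a
field `K`, `N = dim_K D`, and `R` a commutative topological `K`-algebra; put `A = R ⊗_K D` (module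
topology). There are a multiplicative map `ℓ : A → M_N(R)` (the matrix of left multiplication in
a basis `1 ⊗ βᵢ`) and a bi-continuous additive isomorphism `e : Aᴺ ≅ M_N(R)` — namely
`(aᵢ)ᵢ ↦ ∑ᵢ ℓ(aᵢ) r(1 ⊗ βᵢ)`, `r` the matrix of right multiplication, bijective by the Azumaya
property `D ⊗ Dᵒᵖ ≅ End_K(D)` (`bijective_sum_mulLeft_comp_mulRight`) base-changed to `R` — such
that `e (u a) = ℓ(u) e(a)` and `e (a u) = e(a) ℓ(u)` for all `u ∈ Aˣ`, `a ∈ Aᴺ` (coordinatewise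
products). [folklore] -/
theorem ScalarExtension.exists_continuousAddEquiv_pi_matrix [Algebra.IsCentral K D]
    [IsSimpleRing D] [Module.Finite K D] :
    ∃ (ℓ : ScalarExtension K R D →*
        Matrix (Fin (Module.finrank K D)) (Fin (Module.finrank K D)) R)
      (e : (Fin (Module.finrank K D) → ScalarExtension K R D) ≃ₜ+
        Matrix (Fin (Module.finrank K D)) (Fin (Module.finrank K D)) R),
      (∀ (u : (ScalarExtension K R D)ˣ) (a : Fin (Module.finrank K D) → ScalarExtension K R D),
          e (u • a) = Units.map ℓ u • e a) ∧
      (∀ (u : (ScalarExtension K R D)ˣ) (a : Fin (Module.finrank K D) → ScalarExtension K R D),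
          e (Units.opEquiv.symm (MulOpposite.op u) • a) =
            Units.opEquiv.symm (MulOpposite.op (Units.map ℓ u)) • e a) := by
  classical
  set N := Module.finrank K D with hN
  let β : Module.Basis (Fin N) K D := Module.finBasis K D
  let βT : Module.Basis (Fin N) R (R ⊗[K] D) := Algebra.TensorProduct.basis R β
  let ℓ : R ⊗[K] D →ₐ[R] Matrix (Fin N) (Fin N) R := Algebra.leftMulMatrix βT
  let ρ : Fin N → Matrix (Fin N) (Fin N) R := fun i =>
    LinearMap.toMatrix βT βT (LinearMap.mulRight R (βT i))
  -- the sandwich map `Φ (a) = ∑ᵢ ℓ(aᵢ) ρᵢ`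
  let Φ : (Fin N → R ⊗[K] D) →ₗ[R] Matrix (Fin N) (Fin N) R :=
    { toFun := fun a => ∑ i, ℓ (a i) * ρ i
      map_add' := fun a a' => by
        simp only [Pi.add_apply, map_add, add_mul, Finset.sum_add_distrib]
      map_smul' := fun c a => by
        simp only [Pi.smul_apply, map_smul, smul_mul_assoc, RingHom.id_apply, Finset.smul_sum] }
  have hΦ : ∀ a, Φ a = ∑ i, ℓ (a i) * ρ i := fun a => rfl
  -- left multiplication
  have hleft : ∀ (u : R ⊗[K] D) (a : Fin N → R ⊗[K] D),
      Φ (fun i => u * a i) = ℓ u * Φ a := fun u a => by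
    simp only [hΦ, map_mul, Finset.mul_sum, mul_assoc]
  -- left and right multiplications commute
  have hcomm : ∀ (u : R ⊗[K] D) (i : Fin N), ℓ u * ρ i = ρ i * ℓ u := fun u i => by
    change LinearMap.toMatrix βT βT (Algebra.lmul R _ u) * LinearMap.toMatrix βT βT _ =
      LinearMap.toMatrix βT βT _ * LinearMap.toMatrix βT βT (Algebra.lmul R _ u)
    rw [← LinearMap.toMatrix_mul, ← LinearMap.toMatrix_mul]
    congr 1
    ext x
    simp [mul_assoc]
  -- right multiplication
  have hright : ∀ (u : R ⊗[K] D) (a : Fin N → R ⊗[K] D),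
      Φ (fun i => a i * u) = Φ a * ℓ u := fun u a => by
    simp only [hΦ, map_mul, Finset.sum_mul, mul_assoc, hcomm u]
  -- the same map over `K`, surjective by the Azumaya property
  let ΦK : (Fin N → D) → Matrix (Fin N) (Fin N) K := fun a =>
    LinearMap.toMatrix β β (∑ i, LinearMap.mulLeft K (a i) ∘ₗ LinearMap.mulRight K (β i))
  have hΦK : Function.Surjective ΦK :=
    (LinearMap.toMatrix β β).surjective.comp
      (Literature.RingTheory.CentralSimple.bijective_sum_mulLeft_comp_mulRight β).2
  -- base change
  have hℓ : ∀ d : D, ℓ ((1 : R) ⊗ₜ[K] d) =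
      (LinearMap.toMatrix β β (LinearMap.mulLeft K d)).map (algebraMap K R) := fun d => by
    rw [← LinearMap.toMatrix_baseChange]
    change LinearMap.toMatrix βT βT (Algebra.lmul R _ ((1 : R) ⊗ₜ[K] d)) = _
    congr 1
    refine TensorProduct.AlgebraTensorModule.ext fun x y => ?_
    simp [Algebra.TensorProduct.tmul_mul_tmul]
  have hρ : ∀ i,
      ρ i = (LinearMap.toMatrix β β (LinearMap.mulRight K (β i))).map (algebraMap K R) := by
    intro i
    rw [← LinearMap.toMatrix_baseChange]
    change LinearMap.toMatrix βT βT (LinearMap.mulRight R (βT i)) = _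
    congr 1
    refine TensorProduct.AlgebraTensorModule.ext fun x y => ?_
    simp [βT, Algebra.TensorProduct.basis_apply, Algebra.TensorProduct.tmul_mul_tmul]
  have hBC : ∀ a : Fin N → D,
      Φ (fun i => (1 : R) ⊗ₜ[K] a i) = (ΦK a).map (algebraMap K R) := fun a => by
    rw [hΦ]
    simp only [hℓ, hρ, ← RingHom.mapMatrix_apply, ← map_mul, ← _root_.map_sum]
    congr 1
    simp only [ΦK, _root_.map_sum, LinearMap.toMatrix_comp β β β]
  -- surjectivity over `R`
  have hsurj : Function.Surjective Φ := by
    have hE : ∀ s t : Fin N, ∃ a, Φ a = Matrix.single s t (1 : R) := fun s t => by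
      obtain ⟨a, ha⟩ := hΦK (Matrix.single s t 1)
      refine ⟨fun i => (1 : R) ⊗ₜ[K] a i, ?_⟩
      rw [hBC, show ΦK a = _ from ha, Matrix.map_single, map_one]
    choose a ha using hE
    intro M
    obtain ⟨f, rfl⟩ := Matrix.of.surjective M
    refine ⟨∑ s, ∑ t, f s t • a s t, ?_⟩
    calc Φ (∑ s, ∑ t, f s t • a s t) = ∑ s, ∑ t, Matrix.single s t (f s t) := by
          simp only [_root_.map_sum, map_smul, ha, Matrix.smul_single, smul_eq_mul, mul_one]
      _ = Matrix.of f := by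
          rw [Matrix.matrix_eq_sum_single (Matrix.of f)]
          simp only [Matrix.of_apply]
  -- injectivity over `R` (Orzech property)
  have hinj : Function.Injective Φ := by
    let θ : Matrix (Fin N) (Fin N) R ≃ₗ[R] (Fin N → R ⊗[K] D) :=
      (Matrix.ofLinearEquiv R).symm ≪≫ₗ (LinearEquiv.piCongrRight fun _ => βT.equivFun).symm
    have hθ : Function.Injective (θ.toLinearMap ∘ₗ Φ) :=
      OrzechProperty.injective_of_surjective_endomorphism _ (θ.surjective.comp hsurj)
    exact fun x y hxy => hθ (show θ (Φ x) = θ (Φ y) by rw [hxy])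
  let ΦE : (Fin N → R ⊗[K] D) ≃ₗ[R] Matrix (Fin N) (Fin N) R :=
    LinearEquiv.ofBijective Φ ⟨hinj, hsurj⟩
  -- continuity for the module topologies
  letI : TopologicalSpace (R ⊗[K] D) := moduleTopology R (R ⊗[K] D)
  haveI : IsModuleTopology R (R ⊗[K] D) := ⟨rfl⟩
  haveI : ContinuousAdd (R ⊗[K] D) := IsModuleTopology.toContinuousAdd R _
  haveI : ContinuousSMul R (R ⊗[K] D) := IsModuleTopology.toContinuousSMul R _
  haveI : IsModuleTopology R (Matrix (Fin N) (Fin N) R) :=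
    inferInstanceAs (IsModuleTopology R (Fin N → Fin N → R))
  have hc1 : Continuous ΦE := IsModuleTopology.continuous_of_linearMap ΦE.toLinearMap
  have hc2 : Continuous ΦE.symm := IsModuleTopology.continuous_of_linearMap ΦE.symm.toLinearMap
  let e : (Fin N → R ⊗[K] D) ≃ₜ+ Matrix (Fin N) (Fin N) R :=
    { ΦE.toAddEquiv with continuous_toFun := hc1, continuous_invFun := hc2 }
  refine ⟨(ℓ : R ⊗[K] D →* Matrix (Fin N) (Fin N) R),
    (e : (Fin N → ScalarExtension K R D) ≃ₜ+ Matrix (Fin N) (Fin N) R), fun u a => ?_,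
    fun u a => ?_⟩
  · exact hleft (u : ScalarExtension K R D) a
  · exact hright (u : ScalarExtension K R D) a

end Sandwich

/-! ### Discharge of `addHaar_units_smul_eq_op_smul` -/

section Discharge

variable (K : Type) [Field K] [NumberField K] (D : Type u) [Ring D] [Algebra K D]

/-- **Vignéras II §4 (module commun) / Weil IV §3 Cor. of Prop. 3 with IX §2 Prop. 6 Cor. 1** —
discharge of the named fact `addHaar_units_smul_eq_op_smul`: for a central simple
finite-dimensional `K`-algebra `D` over a number field `K` and a unit `u` of `D_𝔸 = 𝔸_K ⊗_K D`,
left and right multiplication by `u` scale every regular additive Haar measure of `D_𝔸` by the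
same factor, `vol(u Z) = vol(Z u)`. Proof: with `N = dim_K D`, the sandwich isomorphism
`D_𝔸ᴺ ≅ M_N(𝔸_K)` (`ScalarExtension.exists_continuousAddEquiv_pi_matrix`) turns coordinatewise
left, resp. right, multiplication by `u` into left, resp. right, multiplication by one matrix
`g ∈ GL_N(𝔸_K)`; these have equal modules (`distribHaarChar_matrix_adele_eq_op`), so
`‖u‖ₗᴺ = ‖u‖ᵣᴺ` (`distribHaarChar_pi`) and `‖u‖ₗ = ‖u‖ᵣ`.
[cite: VignerasLNM800, Ch. II §4 Définition (module) and Ch. III §1; WeilBNT1967 Ch. IV §3 (Cor. of Prop. 3) and Ch. IX §2 Prop. 6 Cor. 1] -/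
theorem addHaar_units_smul_eq_op_smul_holds : addHaar_units_smul_eq_op_smul K D := by
  intro _ _ _ μ _ _ u s
  haveI : LocallyCompactSpace (AdeleRing (𝓞 K) K) := locallyCompactSpace_adeleRing' K
  haveI : LocallyCompactSpace (Matrix (Fin (Module.finrank K D)) (Fin (Module.finrank K D))
      (AdeleRing (𝓞 K) K)) :=
    inferInstanceAs (LocallyCompactSpace
      (Fin (Module.finrank K D) → Fin (Module.finrank K D) → AdeleRing (𝓞 K) K))
  haveI : T2Space (AdeleRing (𝓞 K) K) := t2Space_adeleRing K
  haveI : SecondCountableTopology (AdeleRing (𝓞 K) K) := secondCountableTopology_adeleRing K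
  haveI : SecondCountableTopology (ScalarExtension K (AdeleRing (𝓞 K) K) D) :=
    (ScalarExtension.coordHomeomorph K (AdeleRing (𝓞 K) K) D).secondCountableTopology
  obtain ⟨ℓ, e, hl, hr⟩ :=
    ScalarExtension.exists_continuousAddEquiv_pi_matrix K (AdeleRing (𝓞 K) K) D
  have hN : Module.finrank K D ≠ 0 := Module.finrank_pos.ne'
  have key : leftModule K D u = rightModule K D u := by
    apply pow_left_injective hN
    dsimp only
    rw [leftModule, rightModule, ← Fintype.card_fin (Module.finrank K D),
      ← distribHaarChar_pi (Fin (Module.finrank K D)) u,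
      ← distribHaarChar_pi (Fin (Module.finrank K D)) (Units.opEquiv.symm (MulOpposite.op u)),
      distribHaarChar_eq_of_continuousAddEquiv e u (Units.map ℓ u) (hl u),
      distribHaarChar_eq_of_continuousAddEquiv e _ _ (hr u), distribHaarChar_matrix_adele_eq_op]
  rw [← leftModule_mul_measure K D μ u s, ← rightModule_mul_measure K D μ u s, key]

end Discharge

end Literature.NumberTheory.Automorphic
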